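import Mathlib.MeasureTheory.Integral.IntervalIntegral.Basic
import Mathlib.Analysis.SpecialFunctions.Exp

/-!
# K1L_D (stmt-AnomalousDissipation-27980), glue v2 hypothesis (N2) — CORE: a quasi-monotone dissipation rate makes later-window losses small in
# proportion to the window length (helper, `--supports 27980 --as helper`)

Port note (prover ad-k1loc-p3 g8): planner ad-ideate-p5 g14's crux workfile `Lines/onelevel_N2_quasimonotone.lean` (sha12 4acc19ca080f, rc 0)
VERBATIM modulo the namespace (now `…LagrangianStep.LossCurrency`, next to `…LossCurrency` p690895 / `…LossCurrencyComparability` p692467) and the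
imports (the two Mathlib files actually used instead of `import Mathlib`).

Pure real analysis, no PDE: if `D ≥ 0` is quasi-monotone on `[r₀, s']` (`D t₂ ≤ M · D t₁` for `t₁ ≤ t₂`), then
`∫_{r₁}^{s'} D ≤ M² · ((s' − r₁)/(r₁ − r₀)) · ∫_{r₀}^{r₁} D`, and the loss form used by the §9z glue v2 hypothesis (N2)
(`lossFwd (Um r₁ s′) (Um jR r₁ x) ≤ Cmono·((s′−r₁)/R)·lossFwd (Um jR r₁) x`) follows from the energy inequality on the first
window (`q₁ ≥ 2∫D`) and the energy equality / upper bound on the second (`q₂ ≤ 2∫D`).  The analytic input left to the PDE side is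
the quasi-monotonicity `D′ ≤ C_𝔸‖∇b_{≤m}‖_∞ D` (⇒ `M = exp (C_𝔸 · strain)`), see STATUS 2026-08-29T03:43:57Z.
Cell ad-ideate, planner ad-ideate-p5 g14 (certifier), for lead-k1l-onelevel-p1 g5 memo L12 §3 (N2) / §4.
-/

set_option linter.dupNamespace false

noncomputable section

namespace Summit.AnomalousDissipation.AnomalousDissipation.Theorems.SolenoidalFractalHomogenisation.LagrangianStep.LossCurrency

open MeasureTheory Set

/-- (N2) core, pure real analysis: a quasi-monotone rate integrates over a later window to at most `M² · (length ratio)` times its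
integral over the earlier adjacent window. [folklore] -/
theorem integral_later_le_of_quasiMonotone {D : ℝ → ℝ} {M r₀ r₁ s' : ℝ} (hM : 0 < M)
    (h01 : r₀ < r₁) (h1s : r₁ ≤ s')
    (hD : ∀ t₁ t₂, r₀ ≤ t₁ → t₁ ≤ t₂ → t₂ ≤ s' → D t₂ ≤ M * D t₁)
    (hi₁ : IntervalIntegrable D volume r₀ r₁) (hi₂ : IntervalIntegrable D volume r₁ s') :
    ∫ t in r₁..s', D t ≤ M ^ 2 * ((s' - r₁) / (r₁ - r₀)) * ∫ t in r₀..r₁, D t := by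
  have hM0 : M ≠ 0 := hM.ne'
  have hR : 0 < r₁ - r₀ := sub_pos.2 h01
  have hR0 : r₁ - r₀ ≠ 0 := hR.ne'
  have hup : ∫ t in r₁..s', D t ≤ ∫ _t in r₁..s', M * D r₁ := by
    refine intervalIntegral.integral_mono_on h1s hi₂ (by simp) ?_
    intro t ht
    exact hD r₁ t h01.le ht.1 ht.2
  have hlow : ∫ _t in r₀..r₁, D r₁ / M ≤ ∫ t in r₀..r₁, D t := by
    refine intervalIntegral.integral_mono_on h01.le (by simp) hi₁ ?_
    intro t ht
    rw [div_le_iff₀ hM]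
    calc D r₁ ≤ M * D t := hD t r₁ ht.1 ht.2 h1s
      _ = D t * M := mul_comm _ _
  rw [intervalIntegral.integral_const, smul_eq_mul] at hup hlow
  have hs : 0 ≤ s' - r₁ := sub_nonneg.2 h1s
  calc ∫ t in r₁..s', D t ≤ (s' - r₁) * (M * D r₁) := hup
    _ = M ^ 2 * ((s' - r₁) / (r₁ - r₀)) * ((r₁ - r₀) * (D r₁ / M)) := by
        field_simp
    _ ≤ M ^ 2 * ((s' - r₁) / (r₁ - r₀)) * ∫ t in r₀..r₁, D t := by
        apply mul_le_mul_of_nonneg_left hlow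
        positivity

/-- (N2) in loss form: energy inequality on the first window (`q₁ ≥ 2∫D`), energy upper bound on the second (`q₂ ≤ 2∫D`) and a
quasi-monotone rate give `q₂ ≤ M²·((s′−r₁)/(r₁−r₀))·q₁`. [folklore] -/
theorem loss_later_le_of_quasiMonotone {D : ℝ → ℝ} {M r₀ r₁ s' q₁ q₂ : ℝ} (hM : 0 < M)
    (h01 : r₀ < r₁) (h1s : r₁ ≤ s')
    (hD : ∀ t₁ t₂, r₀ ≤ t₁ → t₁ ≤ t₂ → t₂ ≤ s' → D t₂ ≤ M * D t₁)
    (hi₁ : IntervalIntegrable D volume r₀ r₁) (hi₂ : IntervalIntegrable D volume r₁ s')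
    (hq₁ : 2 * ∫ t in r₀..r₁, D t ≤ q₁) (hq₂ : q₂ ≤ 2 * ∫ t in r₁..s', D t) :
    q₂ ≤ M ^ 2 * ((s' - r₁) / (r₁ - r₀)) * q₁ := by
  have h := integral_later_le_of_quasiMonotone hM h01 h1s hD hi₁ hi₂
  have hs : 0 ≤ s' - r₁ := sub_nonneg.2 h1s
  have hR : 0 < r₁ - r₀ := sub_pos.2 h01
  have hc : 0 ≤ M ^ 2 * ((s' - r₁) / (r₁ - r₀)) := by positivity
  calc q₂ ≤ 2 * ∫ t in r₁..s', D t := hq₂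
    _ ≤ 2 * (M ^ 2 * ((s' - r₁) / (r₁ - r₀)) * ∫ t in r₀..r₁, D t) := by linarith
    _ = M ^ 2 * ((s' - r₁) / (r₁ - r₀)) * (2 * ∫ t in r₀..r₁, D t) := by ring
    _ ≤ M ^ 2 * ((s' - r₁) / (r₁ - r₀)) * q₁ := mul_le_mul_of_nonneg_left hq₁ hc

/-- Quasi-monotonicity from a Grönwall-type pointwise bound: if `D t₂ ≤ exp θ · D t₁` whenever `t₁ ≤ t₂` in the window (e.g. from
`D′ ≤ β D`, `∫ β ≤ θ`), the constant of (N2) is `exp (2θ)`. [folklore] -/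
theorem loss_later_le_of_expBound {D : ℝ → ℝ} {θ r₀ r₁ s' q₁ q₂ : ℝ}
    (h01 : r₀ < r₁) (h1s : r₁ ≤ s')
    (hD : ∀ t₁ t₂, r₀ ≤ t₁ → t₁ ≤ t₂ → t₂ ≤ s' → D t₂ ≤ Real.exp θ * D t₁)
    (hi₁ : IntervalIntegrable D volume r₀ r₁) (hi₂ : IntervalIntegrable D volume r₁ s')
    (hq₁ : 2 * ∫ t in r₀..r₁, D t ≤ q₁) (hq₂ : q₂ ≤ 2 * ∫ t in r₁..s', D t) :
    q₂ ≤ Real.exp (2 * θ) * ((s' - r₁) / (r₁ - r₀)) * q₁ := by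
  have h := loss_later_le_of_quasiMonotone (Real.exp_pos θ) h01 h1s hD hi₁ hi₂ hq₁ hq₂
  have he : Real.exp θ ^ 2 = Real.exp (2 * θ) := by
    rw [← Real.exp_nat_mul]; norm_num
  rw [he] at h
  exact h

end Summit.AnomalousDissipation.AnomalousDissipation.Theorems.SolenoidalFractalHomogenisation.LagrangianStep.LossCurrency

end
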